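import Summits.Ventures.PackingBounds.ThreePointCert.K6Cert

/-!
# κ(6) ≤ 79 (three-point bound, kernel-checked): kernel validation of Gram block R2 (chunks 1–3 of 3)

Framing: lottery ticket; floor = certified bounds/negative ranges. Venture `PackingBounds` (cell
`pub-packcert`), three-point SDP family. Integer data of a feasible point of the Bachoc–Vallentin
semidefinite program (n = 6, s = 1/2, degree d = 9, symmetric
sums of squares), derived by `pub-packcert-sdp/code/cert2lean.py` from the exact rational
certificate `sdp-n6-d9-s1-2-sym.json` of the cell (two independent exact verifiers + referee), in the
units of the kernel checker `ThreePointCert.Check` (soundness `ThreePointCert.Sound`). Generated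
file: plain lists of integers / monomials.
-/

namespace Summit.Ventures.PackingBounds.ThreePointCert.K6

open Literature.Geometry.DiscreteGeometry Literature.Geometry.DiscreteGeometry.PolyCert PolyCert.SPoly

set_option maxHeartbeats 0 in
/-- Block `R2`: rows from 0 (62 rows) of `zᵀ(LLᵀ)z` added to `[]` give `dR2c1` (kernel). -/
theorem okR2_1 : chunkOK K6.gR2 0 62 [] K6.dR2c1 = true := by
  decide +kernel

set_option maxHeartbeats 0 in
/-- Block `R2`: rows from 62 (31 rows) of `zᵀ(LLᵀ)z` added to `dR2c1` give `dR2c2` (kernel). -/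
theorem okR2_2 : chunkOK K6.gR2 62 31 K6.dR2c1 K6.dR2c2 = true := by
  decide +kernel

set_option maxHeartbeats 0 in
/-- Block `R2`: rows from 93 ((gR2.z.length - 93) rows) of `zᵀ(LLᵀ)z` added to `dR2c2` give `eR2` (kernel). -/
theorem okR2_3 : chunkOK K6.gR2 93 (K6.gR2.z.length - 93) K6.dR2c2 K6.eR2 = true := by
  decide +kernel

end Summit.Ventures.PackingBounds.ThreePointCert.K6
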